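import Summits.ResolutionOfSingularities.ResolutionOfSingularities.Theorems.PurelyInseparableDim4WinCertFlatSound
import HarnessLib
import HarnessLib.Audit.Tags

/-!
# Purely inseparable fourfolds — FULL-GAME soundness of flat-absorption certificates without blindness leaves
# (`ffwinCertBL`): every row state `⊗ K` is ESCAPABLE (`StateWins p`, player B over all of `K⁴`), every field `K` of
# characteristic `p`
# [OURS · counted 0 · a certificate format for OUR frame v4, not about resolution]

Census cell «res-dim4-pi» (D-0157 DOOR 2), desk WORD #65 (c); seat res-rescue-typ-3 g8.  Sequel of `…WinCertFlatSound`: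
the same rows and checks MINUS the blindness-leaf disjunct (`ffrowOKL` = `frowOKL` without `fmonoBlindOK`;
`ffwinCertBL`, block form `ffwinCertBL2` / `ffwinCertBL_append_of`), proved sound for the FULL coordinate game
(`StateWins`) via `FlatAbsorb.stateWins_step_add_of_move` and `FlatAbsorb.stateWins_congr`:
**`forall_stateWins_of_ffwinCertBL {T : FCert (ZMod p)} (h : ffwinCertBL p p T = true) (K) [Field K] [CharP K p] :
∀ row ∈ T, StateWins p (row ⊗ K)`** (+ the in-scope corollary).  This lifts p-14's full-game ∀K column (`UCert`,
263 roots of record) by flat absorption.  Nothing here proves resolution of singularities in dimension ≥ 4 /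
characteristic `p`; F4-C(2,2) and `TerminatesSomeRule 2 2`'s refutation are untouched — these are wins from PARTICULAR
roots.  Counted 0; AI work, weaker than expert review.
bears_on: LADDER-RESOLUTION:D157-DOOR2 (res-dim4-pi · full-game ∀K column · flat absorption).
Supports stmt-ResolutionOfSingularities-16155 (helper).
-/


set_option linter.dupNamespace false

noncomputable section
open MvPolynomial Finset
open scoped BigOperators
namespace Summit.ResolutionOfSingularities.ResolutionOfSingularities.Theorems.PIDim4

namespace WinCertFlat

open Literature.AlgebraicGeometry.Resolution
open Literature.AlgebraicGeometry.Resolution.CentreBlowup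
open StepKit WinCertSound InScopeWinCert ScopeCover ScopeBlind WinCertAllFields FlatAbsorb

/-! ## 0. The full-game checker `ffwinCertBL` (no blindness leaves) -/

section Checker

variable {k : Type} [Field k] [DecidableEq k] [Fintype k]

/-- **The full-game row check**: origin not `q`-fold, or a MOVE row (as in `frowOKL`, without the blind-leaf disjunct).
[folklore] -/
def ffrowOKL (p q : ℕ) (rest : FCert k) (row : FRow k) : Bool :=
  !(permB q Finset.univ row.1.1.L) ||
    (permB q row.1.2.1 row.1.1.L &&
      decide (∀ j ∈ row.1.2.1, ∀ b : Fin 4 → k, b j = 0 →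
        ireplyOK q (rest.map fun r : FRow k => r.1) row.1.1 row.1.2.1 j b = true ∨
          ∃ φ : Flat k, φ ∈ row.2.2 ∧ φ.j = j ∧ onFlatB φ b = true) &&
      decide (∀ φ : Flat k, φ ∈ row.2.2 → φ.j ∈ row.1.2.1 ∧ φ.b0 φ.j = 0 ∧
        baseOK q rest (stepD q row.1.2.1 φ.j φ.b0 row.1.1) φ.U = true) &&
      decide (∀ j ∈ row.1.2.1, coverOKL p q row.1.1 row.1.2.1 j row.2.1 row.2.2 = true))

/-- **The full-game checker.** [folklore] -/
def ffwinCertBL (p q : ℕ) : FCert k → Bool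
  | [] => true
  | row :: rest => ffrowOKL p q rest row && ffwinCertBL p q rest

/-- Block form (for splitting one long certificate over several `decide` calls). [folklore] -/
def ffwinCertBL2 (p q : ℕ) : FCert k → FCert k → Bool
  | [], _ => true
  | row :: A, B => ffrowOKL p q (A ++ B) row && ffwinCertBL2 p q A B

/-- `ffwinCertBL (A ++ B)` splits. [folklore] -/
theorem ffwinCertBL_append (p q : ℕ) : ∀ A B : FCert k,
    ffwinCertBL p q (A ++ B) = (ffwinCertBL2 p q A B && ffwinCertBL p q B)
  | [], B => by simp [ffwinCertBL2]
  | row :: A, B => by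
    rw [List.cons_append, show ffwinCertBL p q (row :: (A ++ B)) = (ffrowOKL p q (A ++ B) row && ffwinCertBL p q (A ++ B))
      from rfl, show ffwinCertBL2 p q (row :: A) B = (ffrowOKL p q (A ++ B) row && ffwinCertBL2 p q A B) from rfl,
      ffwinCertBL_append p q A B, Bool.and_assoc]

/-- Assembling a certificate check from a block check and the check of the tail. [folklore] -/
theorem ffwinCertBL_append_of (p q : ℕ) {A B : FCert k} (hA : ffwinCertBL2 p q A B = true)
    (hB : ffwinCertBL p q B = true) : ffwinCertBL p q (A ++ B) = true := by
  rw [ffwinCertBL_append, hA, hB, Bool.and_self]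

end Checker

/-! ## 1. The inductive invariant -/

/-- The state of a row, base-changed along `f`. [folklore] -/
def frowState {p : ℕ} [Fact p.Prime] {K : Type} [Field K] (f : ZMod p →+* K) (row : FRow (ZMod p)) : State K :=
  ⟨MvPolynomial.map f row.1.1.toState.F, row.1.1.toState.r, row.1.1.toState.exc⟩

/-- **A good row** over `K`: its state is in-scope escapable, and — if it is a non-blind `p`-fold row — its centre
is permissible and every `K`-edge through its centre leads to an in-scope escapable state. [folklore] -/
def FRowGood {p : ℕ} [Fact p.Prime] {K : Type} [Field K] [DecidableEq K] (f : ZMod p →+* K)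
    (row : FRow (ZMod p)) : Prop :=
  StateWins p (frowState f row) ∧
    (row.1.2.2 = none → permB p Finset.univ row.1.1.L = true →
      IsPermissibleCentre p row.1.2.1 (frowState f row).F ∧
        ∀ t, Edge p row.1.2.1 (frowState f row) t → StateWins p t)

/-! ## 2. Soundness of one row -/

/-- The edges through the centre of a MOVE row all lead to in-scope escapable states. [folklore] -/
theorem fedges_of_move {p : ℕ} [Fact p.Prime] {K : Type} [Field K] [CharP K p] [DecidableEq K]
    (f : ZMod p →+* K) {rest : FCert (ZMod p)} (hrest : ∀ r ∈ rest, FRowGood f r) {row : FRow (ZMod p)}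
    (hall : ∀ j ∈ row.1.2.1, ∀ b : Fin 4 → ZMod p, b j = 0 →
      ireplyOK p (rest.map fun r : FRow (ZMod p) => r.1) row.1.1 row.1.2.1 j b = true ∨
        ∃ φ : Flat (ZMod p), φ ∈ row.2.2 ∧ φ.j = j ∧ onFlatB φ b = true)
    (hflats : ∀ φ : Flat (ZMod p), φ ∈ row.2.2 → φ.j ∈ row.1.2.1 ∧ φ.b0 φ.j = 0 ∧
      baseOK p rest (stepD p row.1.2.1 φ.j φ.b0 row.1.1) φ.U = true)
    (hcov : ∀ j ∈ row.1.2.1, coverOKL p p row.1.1 row.1.2.1 j row.2.1 row.2.2 = true) :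
    ∀ t, Edge p row.1.2.1 (frowState f row) t → StateWins p t := by
  classical
  -- a flat of chart `j` absorbs every `K`-point on it
  have hflat : ∀ (j : Fin 4) (φ : Flat (ZMod p)), φ ∈ row.2.2 → φ.j = j → ∀ b : Fin 4 → K, OnFlat f φ b →
      StateWins p (step p row.1.2.1 j b (frowState f row)) := by
    intro j φ hφ hφj b hb
    obtain ⟨-, -, hbase⟩ := hflats φ hφ
    obtain ⟨r, hr, hrc, hnone, huniv, hpermr, hdisj⟩ := exists_of_baseOK hbase
    obtain ⟨v, hv, rfl⟩ := exists_add_of_onFlat f hb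
    have hgood := (hrest r hr).2 hnone huniv
    -- the base child over `K` is the state of `r`, up to the books
    have hstep : step p row.1.2.1 j (f ∘ φ.b0) (frowState f row) =
        ⟨MvPolynomial.map f (stepD p row.1.2.1 φ.j φ.b0 row.1.1).toState.F,
          (stepD p row.1.2.1 φ.j φ.b0 row.1.1).toState.r, (stepD p row.1.2.1 φ.j φ.b0 row.1.1).toState.exc⟩ := by
      rw [frowState, ← hφj, BaseChange.step_map f p row.1.2.1 φ.j φ.b0 row.1.1.toState, step_toState]
    have hF : (step p row.1.2.1 j (f ∘ φ.b0) (frowState f row)).F = (frowState f r).F := by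
      rw [hstep, frowState, hrc]
    refine stateWins_step_add_of_move (S' := r.1.2.1) (fun i hi => hv i ?_) ?_ ?_
    · exact fun hiU => (Finset.disjoint_left.mp hdisj) hi hiU
    · rw [hF]; exact hgood.1
    · intro t ht
      obtain ⟨t', ht', hFt⟩ := edge_congr hF ht
      exact stateWins_congr (hgood.2 t' ht') t hFt
  rintro s' ⟨j, b, hj, hbj, heq, hne, rfl⟩
  have h0 : ∀ φ : Flat (ZMod p), φ ∈ row.2.2 → φ.b0 φ.j = 0 := fun φ hφ => (hflats φ hφ).2.1
  rcases rational_or_onFlatL f (hcov j hj) h0 hbj heq with ⟨b₀, hb₀j, rfl⟩ | ⟨φ, hφ, hφj, hon⟩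
  · -- a rational reply
    rcases hall j hj b₀ hb₀j with h | ⟨φ, hφ, hφj, honB⟩
    · have heq₀ : IsEquimultiplePoint p row.1.2.1 j b₀ row.1.1.toState :=
        (BaseChange.isEquimultiplePoint_map_ringHom_iff f p row.1.2.1 j b₀ row.1.1.toState).mp heq
      have hstep := BaseChange.step_map f p row.1.2.1 j b₀ row.1.1.toState
      unfold ireplyOK at h
      rw [Bool.or_eq_true, Bool.or_eq_true] at h
      rcases h with (h1 | h2) | h3
      · rw [Bool.not_eq_true', ← Bool.not_eq_true] at h1
        exact absurd ((isEquimultiplePoint_iff p row.1.2.1 j b₀ row.1.1).mp heq₀) h1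
      · exfalso
        apply hne
        show (step p row.1.2.1 j (f ∘ b₀) (frowState f row)).F = 0
        rw [frowState, hstep]
        show MvPolynomial.map f (step p row.1.2.1 j b₀ row.1.1.toState).F = 0
        have hz : (step p row.1.2.1 j b₀ row.1.1.toState).F = 0 := by
          by_contra hnz
          have := (step_F_ne_zero_iff p row.1.2.1 j b₀ row.1.1).mp hnz
          rw [h2] at this
          exact Bool.noConfusion this
        rw [hz, map_zero]
      · obtain ⟨r, hr, hrc⟩ := exists_of_ichildIn h3
        obtain ⟨ur, hur, rfl⟩ := List.mem_map.mp hr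
        show StateWins p (step p row.1.2.1 j (f ∘ b₀) (frowState f row))
        rw [frowState, hstep, step_toState, hrc]
        exact (hrest ur hur).1
    · exact hflat j φ hφ hφj _ (onFlat_of_onFlatB f honB)
  · exact hflat j φ hφ hφj b hon

/-- **SOUNDNESS of one row over `K` (full game).** [folklore] -/
theorem frowGood_of_ffrowOKL {p : ℕ} [Fact p.Prime] {K : Type} [Field K] [CharP K p] [DecidableEq K]
    (f : ZMod p →+* K) {rest : FCert (ZMod p)} (hrest : ∀ r ∈ rest, FRowGood f r) {row : FRow (ZMod p)}
    (h : ffrowOKL p p rest row = true) : FRowGood f row := by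
  classical
  unfold ffrowOKL at h
  rw [Bool.or_eq_true] at h
  rcases h with ht | hm
  · -- origin not `p`-fold: no permissible centre over `K`
    rw [Bool.not_eq_true'] at ht
    constructor
    · refine Game.Wins.terminal fun S hS => ?_
      exact no_permissible_of_not_permB ht S ((BaseChange.isPermissibleCentre_map_iff f p S _).mp hS)
    · intro _ huniv
      rw [ht] at huniv
      exact absurd huniv Bool.false_ne_true
  · rw [Bool.and_eq_true, Bool.and_eq_true, Bool.and_eq_true, decide_eq_true_eq, decide_eq_true_eq,
      decide_eq_true_eq] at hm
    obtain ⟨⟨⟨hS, hall⟩, hflats⟩, hcov⟩ := hm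
    have hperm : IsPermissibleCentre p row.1.2.1 (frowState f row).F :=
      (BaseChange.isPermissibleCentre_map_iff f p row.1.2.1 _).mpr ((isPermissibleCentre_iff p row.1.2.1 row.1.1.L).mpr hS)
    have hedges := fedges_of_move f hrest hall hflats hcov
    exact ⟨Game.Wins.move (m := row.1.2.1) hperm hedges, fun _ _ => ⟨hperm, hedges⟩⟩

/-! ## 3. Soundness of a certificate over every field of characteristic `p` -/

/-- **SOUNDNESS OVER EVERY FIELD OF CHARACTERISTIC `p`**: every row of a checked certificate is good over `K`.
[folklore] -/
theorem frowGood_of_ffwinCertBL {p : ℕ} [Fact p.Prime] {K : Type} [Field K] [CharP K p] [DecidableEq K]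
    (f : ZMod p →+* K) : ∀ {T : FCert (ZMod p)}, ffwinCertBL p p T = true → ∀ row ∈ T, FRowGood f row
  | [], _ => fun row hrow => absurd hrow List.not_mem_nil
  | row :: rest, h => by
    unfold ffwinCertBL at h
    rw [Bool.and_eq_true] at h
    have hrest := frowGood_of_ffwinCertBL f h.2
    intro r hr
    rcases List.mem_cons.mp hr with rfl | hr'
    · exact frowGood_of_ffrowOKL f hrest h.1
    · exact hrest r hr'

/-- **`∀ K` form, full game**: for every field `K` of characteristic `p`, every row state `⊗ K` of a checked
certificate is ESCAPABLE (`StateWins p`: FULL coordinate game at `(p, p)`, player B ranging over ALL of `K⁴`).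
[folklore] -/
theorem forall_stateWins_of_ffwinCertBL {p : ℕ} [Fact p.Prime] {T : FCert (ZMod p)}
    (h : ffwinCertBL p p T = true) (K : Type) [Field K] [CharP K p] [DecidableEq K] :
    ∀ row ∈ T, StateWins p
      (⟨MvPolynomial.map (ZMod.castHom (dvd_refl p) K) row.1.1.toState.F, row.1.1.toState.r,
        row.1.1.toState.exc⟩ : State K) :=
  fun row hrow => (frowGood_of_ffwinCertBL (ZMod.castHom (dvd_refl p) K) h row hrow).1

/-- Hence in-scope escapable over every field of characteristic `p`. [folklore] -/
theorem forall_inScopeStateWins_of_ffwinCertBL {p : ℕ} [Fact p.Prime] {T : FCert (ZMod p)}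
    (h : ffwinCertBL p p T = true) (K : Type) [Field K] [CharP K p] [DecidableEq K] :
    ∀ row ∈ T, InScopeStateWins p
      (⟨MvPolynomial.map (ZMod.castHom (dvd_refl p) K) row.1.1.toState.F, row.1.1.toState.r,
        row.1.1.toState.exc⟩ : State K) :=
  fun row hrow => inScopeStateWins_of_stateWins (forall_stateWins_of_ffwinCertBL h K row hrow)

end WinCertFlat

end Summit.ResolutionOfSingularities.ResolutionOfSingularities.Theorems.PIDim4

end
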